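import Literature.Analysis.FluidPDE.ChaeAsymptoticallySelfSimilar
import HarnessLib

/-!
# Chae 2007, Theorem 1.5: proofs companion (the radius claim and the similarity variables)

Analysis/FluidPDE proofs file (theorems only: no definitions, no named facts) accompanying
`Literature/Analysis/FluidPDE/ChaeAsymptoticallySelfSimilar.lean`, which vendors D. Chae,
*Nonexistence of asymptotically self-similar singularities in the Euler and the Navier–Stokes
equations*, Math. Ann. 338 (2007) 435–449 = arXiv:math/0604234, **Theorem 1.5** as the named fact
`chae2007_asymptoticallySelfSimilar_local`, with Chae's scaled local deviation
`chaeLocalDeviation T z q R v V t =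
  (T−t)^{(q−3)/(2q)} · sup_{t<τ<T} ‖v(·,τ) − (T−τ)^{-1/2} V((·−z)/√(T−τ))‖_{L^q(B(z, R√(T−t)))}`.

This file PROVES the first step of the printed proof of Theorem 1.5 (arXiv pp. 7–8, "We first
claim that in the case `q ∈ [3, ∞)` the condition (1.15) for some `R ∈ (0, ∞)` is equivalent to
(3.8) for all `R ∈ (0, ∞)`"), for the tree's honest `ℝ≥0∞`-valued deviation:

* `biSup_eLpNorm_ball_mono` — the inner supremum is monotone in the ball and antitone in the lower
  time (the "obvious inequality" (3.9) and the inclusion (3.10));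
* `chaeLocalDeviation_mono_radius` — `R₁ ≤ R₂ ⟹ dev(R₁, t) ≤ dev(R₂, t)` ((3.9); any `q`);
* `chaeLocalDeviation_le_of_le_radius` — for `q ≥ 3`, `0 < R₁ ≤ R₂` and `t₂ < T`:
  `dev(R₂, t₂) ≤ dev(R₁, t₁)` with `t₁ = T − (R₂/R₁)²(T − t₂)` ((3.10)–(3.11): the balls
  `B(z, R₂√(T−t₂)) = B(z, R₁√(T−t₁))` coincide, `(t₂, T) ⊆ (t₁, T)`, and
  `(T−t₂)^{(q−3)/(2q)} ≤ (T−t₁)^{(q−3)/(2q)}` because the exponent is nonnegative iff `q ≥ 3`);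
* `tendsto_chaeLocalDeviation_of_radius_le` (any `q`) and `tendsto_chaeLocalDeviation_of_le_radius`
  (`q ≥ 3`) — the two halves (3.9)/(3.12) of the claim as statements about `lim_{t↑T} = 0`;
* `chae2007_claim` — **the claim**: for `q ≥ 3`, `dev(R₀, ·) → 0` as `t ↑ T` for one `R₀ > 0`
  implies `dev(R, ·) → 0` for every `R > 0`;
* `forall_tendsto_chaeLocalDeviation_of_hyp` — "Hence, for all `q ∈ [2, ∞)` either the condition
  (i), or condition (ii) of Theorem 1.5 implies that (1.15) holds for all `R > 0`" (p. 8, l. 1–3):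
  the disjunctive hypothesis of `chae2007_asymptoticallySelfSimilar_local` in normal form.

Chae states the claim for limits; here limits `= 0` along `𝓝[<] T` are what the fact uses, and
the printed `lim sup` sandwich (3.11)–(3.12) becomes a pointwise inequality composed with the
affine reparametrisation `t₂ ↦ t₁(t₂) = T − (R₂/R₁)²(T − t₂)`, which tends to `T` from below
(Chae additionally takes `t₁ ∈ (0, T)`, immaterial for the limit).

It also PROVES the second step, the **similarity variables** (arXiv p. 8, (3.13)–(3.14): "Then,
(1.15) is written as `lim_{s→∞} ‖V(·, s) − V̄‖_{L^q(B(0, R))} = 0`"), in the tree's rescaling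
vocabulary (`nsRescale`, `lerayBackward` of `FluidPDE/SelfSimilar`):

* `chaeLocalDeviation_eq_iSup_similarity` — for `t < T` and `λ = √(T−t)`,
  `dev(R, t) = sup_{−1<s<0} ‖v_λ(s) − u_V(s)‖_{L^q(B(0,R))}` with the blow-up rescaling
  `v_λ = nsRescale λ (v(T + ·, z + ·))` about `(T, z)` and the backward self-similar field
  `u_V = lerayBackward ½ 0 V` (from the pointwise identity
  `smul_deviation_eq_nsRescale_sub_lerayBackward`, the change of variables
  `eLpNorm_comp_add_smul_restrict_ball` on balls of `ℝ³`, the Jacobian bookkeeping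
  `enorm_sqrt_mul_rpow_eq` : `λ^{1−3/q} = (T−t)^{(q−3)/(2q)}`, and `biSup_Ioo_reparam`);
* `tendsto_iSup_nsRescale_sub_lerayBackward` — hence `dev(R, ·) → 0` as `t ↑ T` gives
  `sup_{−1<s<0} ‖v_λ(s) − u_V(s)‖_{L^q(B(0,R))} → 0` as `λ ↓ 0`.

The remaining steps of the printed proof (the weak limit `λ → 0` making `V̄` a very weak
solution of Leray's system, its regularity, Nečas–Růžička–Šverák / Tsai for the profile, the
suitability of `v` up to the final time and Gustafson–Kang–Tsai's ε-regularity with a Hölder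
conclusion) are NOT here; see the module docstring of the fact file for the map onto the tree.

## References

* D. Chae, Math. Ann. 338 (2007) 435–449 = arXiv:math/0604234, Theorem 1.5 and its proof,
  displays (3.8)–(3.14) (arXiv pp. 7–8) [Chae2007].
-/

noncomputable section

open _root_.MeasureTheory Set Function Filter Metric
open scoped NNReal ENNReal _root_.Topology

namespace Literature.Analysis.FluidPDE

variable {T : ℝ} {z : EuclideanSpace ℝ (Fin 3)} {q : ℝ≥0}
  {v : ℝ → EuclideanSpace ℝ (Fin 3) → EuclideanSpace ℝ (Fin 3)}
  {V : EuclideanSpace ℝ (Fin 3) → EuclideanSpace ℝ (Fin 3)}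

/-! ### Monotonicity of the inner supremum -/

/-- The inner supremum of Chae's deviation,
`sup_{t<τ<T} ‖v(τ) − (T−τ)^{-1/2}V((·−z)/√(T−τ))‖_{L^q(B(z,ρ))}`, is monotone in the radius `ρ`
of the ball and antitone in the lower time `t` (Chae 2007, proof of Thm 1.5, the "obvious
inequality" (3.9) and the inclusion (3.10): `L^q` norms grow with the domain, suprema with the
index set). [cite: Chae2007, proof of Thm 1.5, (3.9)–(3.10) (arXiv p. 7)] -/
theorem biSup_eLpNorm_ball_mono (T : ℝ) (z : EuclideanSpace ℝ (Fin 3)) (q : ℝ≥0)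
    (v : ℝ → EuclideanSpace ℝ (Fin 3) → EuclideanSpace ℝ (Fin 3))
    (V : EuclideanSpace ℝ (Fin 3) → EuclideanSpace ℝ (Fin 3))
    {t₁ t₂ ρ₁ ρ₂ : ℝ} (ht : t₁ ≤ t₂) (hρ : ρ₁ ≤ ρ₂) :
    (⨆ τ ∈ Ioo t₂ T, eLpNorm
        (fun x => v τ x - (Real.sqrt (T - τ))⁻¹ • V ((Real.sqrt (T - τ))⁻¹ • (x - z)))
        (q : ℝ≥0∞) (volume.restrict (ball z ρ₁))) ≤
      ⨆ τ ∈ Ioo t₁ T, eLpNorm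
        (fun x => v τ x - (Real.sqrt (T - τ))⁻¹ • V ((Real.sqrt (T - τ))⁻¹ • (x - z)))
        (q : ℝ≥0∞) (volume.restrict (ball z ρ₂)) := by
  refine iSup₂_le fun τ hτ => ?_
  have hτ' : τ ∈ Ioo t₁ T := ⟨ht.trans_lt hτ.1, hτ.2⟩
  refine le_trans ?_ (le_iSup₂ (f := fun τ (_ : τ ∈ Ioo t₁ T) => eLpNorm
    (fun x => v τ x - (Real.sqrt (T - τ))⁻¹ • V ((Real.sqrt (T - τ))⁻¹ • (x - z)))
    (q : ℝ≥0∞) (volume.restrict (ball z ρ₂))) τ hτ')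
  exact eLpNorm_mono_measure _ (Measure.restrict_mono (ball_subset_ball hρ) le_rfl)

/-- **Chae's deviation is monotone in the radius parameter**: for `R₁ ≤ R₂` and every `t`,
`dev(R₁, t) ≤ dev(R₂, t)` (Chae 2007, proof of Thm 1.5, (3.9): `B(z, R₁√(T−t)) ⊆ B(z, R₂√(T−t))`;
any `q`). [cite: Chae2007, proof of Thm 1.5, (3.9) (arXiv p. 7)] -/
theorem chaeLocalDeviation_mono_radius {R₁ R₂ : ℝ} (hR : R₁ ≤ R₂) (t : ℝ) :
    chaeLocalDeviation T z q R₁ v V t ≤ chaeLocalDeviation T z q R₂ v V t := by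
  rw [chaeLocalDeviation_def, chaeLocalDeviation_def]
  refine mul_le_mul' le_rfl ?_
  exact biSup_eLpNorm_ball_mono T z q v V le_rfl
    (mul_le_mul_of_nonneg_right hR (Real.sqrt_nonneg _))

/-- **From a larger radius to a smaller one** (Chae 2007, proof of Thm 1.5, (3.9) with
`lim_{t↑T}`): if `dev(R₂, t) → 0` as `t ↑ T` then `dev(R₁, t) → 0` for every `R₁ ≤ R₂` (any `q`;
squeeze between `0` and `dev(R₂, ·)`). [cite: Chae2007, proof of Thm 1.5, (3.9) (arXiv p. 7)] -/
theorem tendsto_chaeLocalDeviation_of_radius_le {R₁ R₂ : ℝ} (hR : R₁ ≤ R₂)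
    (h : Tendsto (chaeLocalDeviation T z q R₂ v V) (𝓝[<] T) (𝓝 0)) :
    Tendsto (chaeLocalDeviation T z q R₁ v V) (𝓝[<] T) (𝓝 0) :=
  tendsto_of_tendsto_of_tendsto_of_le_of_le tendsto_const_nhds h (fun _ => zero_le)
    fun t => chaeLocalDeviation_mono_radius hR t

/-! ### From a smaller radius to a larger one (`q ≥ 3`) -/

/-- **The key inequality of Chae's claim** (Chae 2007, proof of Thm 1.5, (3.10)–(3.11)): let
`q ≥ 3`, `0 < R₁ ≤ R₂` and `t₂ < T`, and put `t₁ := T − (R₂/R₁)²(T − t₂)` (so `t₁ ≤ t₂` and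
`B(z, R₂√(T−t₂)) = B(z, R₁√(T−t₁))`, the equality case of the inclusion (3.10)). Then
`(T−t₂)^{(q−3)/(2q)} sup_{t₂<τ<T} ‖f(τ)‖_{L^q(B(z,R₂√(T−t₂)))}
  ≤ (T−t₁)^{(q−3)/(2q)} sup_{t₁<τ<T} ‖f(τ)‖_{L^q(B(z,R₁√(T−t₁)))}`, i.e.
`dev(R₂, t₂) ≤ dev(R₁, t₁)`: the suprema compare by `(t₂, T) ⊆ (t₁, T)` on the common ball, and
the powers by `T − t₂ ≤ T − t₁` since the exponent `(q−3)/(2q)` is nonnegative ("if `q ≥ 3`").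
[cite: Chae2007, proof of Thm 1.5, (3.10)–(3.11) (arXiv p. 7)] -/
theorem chaeLocalDeviation_le_of_le_radius (hq : 3 ≤ q) {R₁ R₂ : ℝ} (hR₁ : 0 < R₁)
    (hR : R₁ ≤ R₂) {t₂ : ℝ} (ht₂ : t₂ < T) :
    chaeLocalDeviation T z q R₂ v V t₂ ≤
      chaeLocalDeviation T z q R₁ v V (T - (R₂ / R₁) ^ 2 * (T - t₂)) := by
  -- the ratio `c = (R₂/R₁)² ≥ 1` and the earlier time `t₁ = T - c (T - t₂) ≤ t₂`
  have hc1 : 1 ≤ (R₂ / R₁) ^ 2 := by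
    have h1 : 1 ≤ R₂ / R₁ := by rwa [le_div_iff₀ hR₁, one_mul]
    nlinarith
  have hTt₂ : 0 ≤ T - t₂ := (sub_pos.2 ht₂).le
  have hsub : T - (T - (R₂ / R₁) ^ 2 * (T - t₂)) = (R₂ / R₁) ^ 2 * (T - t₂) := by ring
  have ht₁t₂ : T - (R₂ / R₁) ^ 2 * (T - t₂) ≤ t₂ := by nlinarith
  have hle : T - t₂ ≤ T - (T - (R₂ / R₁) ^ 2 * (T - t₂)) := by rw [hsub]; nlinarith
  -- the balls coincide: `R₁ √(c (T - t₂)) = R₂ √(T - t₂)`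
  have hball : R₁ * Real.sqrt (T - (T - (R₂ / R₁) ^ 2 * (T - t₂))) = R₂ * Real.sqrt (T - t₂) := by
    rw [hsub, Real.sqrt_mul (sq_nonneg _), Real.sqrt_sq (div_pos (hR₁.trans_le hR) hR₁).le]
    field_simp
  -- the exponent `(q - 3)/(2q)` is nonnegative for `q ≥ 3`
  have hq' : (3 : ℝ) ≤ (q : ℝ) := by exact_mod_cast hq
  have hγ : 0 ≤ ((q : ℝ) - 3) / (2 * (q : ℝ)) := div_nonneg (by linarith) (by positivity)
  rw [chaeLocalDeviation_def, chaeLocalDeviation_def, hball]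
  refine mul_le_mul' ?_ (biSup_eLpNorm_ball_mono T z q v V ht₁t₂ le_rfl)
  exact ENNReal.ofReal_le_ofReal (Real.rpow_le_rpow hTt₂ hle hγ)

/-- **From a smaller radius to a larger one, `q ≥ 3`** (Chae 2007, proof of Thm 1.5,
(3.10)–(3.12): "Taking `lim sup_{t₂↑T}` in the left hand side of (3.11), and then `lim sup_{t₁↑T}`
in the right hand side"): if `q ≥ 3`, `0 < R₁ ≤ R₂` and `dev(R₁, t) → 0` as `t ↑ T`, then
`dev(R₂, t) → 0` as `t ↑ T`. Proof: compose the hypothesis with the reparametrisation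
`t₂ ↦ T − (R₂/R₁)²(T − t₂)`, which tends to `T` from below, and squeeze with
`chaeLocalDeviation_le_of_le_radius`. [cite: Chae2007, proof of Thm 1.5, (3.10)–(3.12) (arXiv pp. 7–8)] -/
theorem tendsto_chaeLocalDeviation_of_le_radius (hq : 3 ≤ q) {R₁ R₂ : ℝ} (hR₁ : 0 < R₁)
    (hR : R₁ ≤ R₂) (h : Tendsto (chaeLocalDeviation T z q R₁ v V) (𝓝[<] T) (𝓝 0)) :
    Tendsto (chaeLocalDeviation T z q R₂ v V) (𝓝[<] T) (𝓝 0) := by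
  set c : ℝ := (R₂ / R₁) ^ 2 with hc
  have hc0 : 0 < c := by
    rw [hc]
    exact pow_pos (div_pos (hR₁.trans_le hR) hR₁) 2
  -- the reparametrisation `φ t = T - c (T - t)` tends to `T` from below
  set φ : ℝ → ℝ := fun t => T - c * (T - t) with hφ
  have hφT : φ T = T := by simp [hφ]
  have hφc : Continuous φ := by
    rw [hφ]
    fun_prop
  have hmaps : MapsTo φ (Iio T) (Iio T) := by
    intro t ht
    simp only [mem_Iio, hφ] at ht ⊢
    nlinarith [mul_pos hc0 (sub_pos.2 ht)]
  have hφlim : Tendsto φ (𝓝[<] T) (𝓝[<] T) := by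
    have h1 := hφc.continuousWithinAt.tendsto_nhdsWithin hmaps (x := T) (s := Iio T)
    rwa [hφT] at h1
  -- squeeze `0 ≤ dev(R₂, t) ≤ dev(R₁, φ t)` for `t < T`
  refine tendsto_of_tendsto_of_tendsto_of_le_of_le' tendsto_const_nhds (h.comp hφlim)
    (Eventually.of_forall fun _ => zero_le) ?_
  filter_upwards [self_mem_nhdsWithin] with t ht
  exact chaeLocalDeviation_le_of_le_radius hq hR₁ hR ht

/-- **Chae's claim** (Chae 2007, proof of Thm 1.5, arXiv pp. 7–8: "in the case `q ∈ [3, ∞)` the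
condition (1.15) for some `R ∈ (0, ∞)` is equivalent to (3.8) for all `R ∈ (0, ∞)`"): for
`q ≥ 3`, if Chae's deviation tends to `0` as `t ↑ T` for one radius parameter `R₀ > 0`, then it
does so for every `R > 0` (smaller `R` by (3.9), larger `R` by (3.10)–(3.12)).
[cite: Chae2007, proof of Thm 1.5, claim (arXiv pp. 7–8)] -/
theorem chae2007_claim (hq : 3 ≤ q) {R₀ : ℝ} (hR₀ : 0 < R₀)
    (h : Tendsto (chaeLocalDeviation T z q R₀ v V) (𝓝[<] T) (𝓝 0)) {R : ℝ} (_hR : 0 < R) :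
    Tendsto (chaeLocalDeviation T z q R v V) (𝓝[<] T) (𝓝 0) := by
  rcases le_total R R₀ with hle | hle
  · exact tendsto_chaeLocalDeviation_of_radius_le hle h
  · exact tendsto_chaeLocalDeviation_of_le_radius hq hR₀ hle h

/-- **The hypothesis of Theorem 1.5 in normal form** (Chae 2007, proof of Thm 1.5, arXiv p. 8,
l. 1–3: "Hence, for all `q ∈ [2, ∞)` either the condition (i), or condition (ii) of Theorem 1.5
implies that (1.15) holds for all `R > 0`"): under the disjunctive hypothesis of
`chae2007_asymptoticallySelfSimilar_local` — (i) `q ≥ 3` and the deviation tends to `0` for some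
`R > 0`, or (ii) `2 ≤ q < 3` and it tends to `0` for all `R > 0` — one has `q ≥ 2` and the
deviation tends to `0` as `t ↑ T` for every `R > 0`. [cite: Chae2007, proof of Thm 1.5 (arXiv p. 8)] -/
theorem forall_tendsto_chaeLocalDeviation_of_hyp
    (hq : (3 ≤ q ∧ ∃ R : ℝ, 0 < R ∧ Tendsto (chaeLocalDeviation T z q R v V) (𝓝[<] T) (𝓝 0)) ∨
      (2 ≤ q ∧ q < 3 ∧
        ∀ R : ℝ, 0 < R → Tendsto (chaeLocalDeviation T z q R v V) (𝓝[<] T) (𝓝 0))) :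
    2 ≤ q ∧ ∀ R : ℝ, 0 < R → Tendsto (chaeLocalDeviation T z q R v V) (𝓝[<] T) (𝓝 0) := by
  rcases hq with ⟨hq3, R₀, hR₀, h⟩ | ⟨hq2, -, h⟩
  · have h23 : (2 : ℝ≥0) ≤ 3 := by norm_num
    exact ⟨h23.trans hq3, fun R hR => chae2007_claim hq3 hR₀ h hR⟩
  · exact ⟨hq2, h⟩

/-! ### Similarity variables (Chae 2007, proof of Thm 1.5, (3.13)–(3.14))

Chae's change of variables `y = (x − z)/√(T−t)`, `s = ½ log(T/(T−t))`, `v = (T−t)^{-1/2} V(y, s)`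
((3.13)) turns (1.15) into `lim_{s→∞} ‖V(·, s) − V̄‖_{L^q(B(0,R))} = 0` ((3.14)). In the tree's
vocabulary the same computation reads: with `λ = √(T−t)` and the Navier–Stokes rescaling
`v_λ = nsRescale λ (v(T + ·, z + ·))` (`v_λ(s, y) = λ v(T + λ²s, z + λy)`), the deviation is
`dev(R, t) = sup_{−1<s<0} ‖v_λ(s) − u_{V̄}(s)‖_{L^q(B(0,R))}`, where
`u_{V̄} = lerayBackward ½ 0 V̄` (`u_{V̄}(s, y) = (−s)^{-1/2} V̄(y/√(−s))`) is the backward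
self-similar field with profile `V̄` blowing up at `(0, 0)`: the power `(T−t)^{(q−3)/(2q)} =
λ^{1−3/q}` is exactly the Jacobian bookkeeping `λ · λ^{-3/q}` of `x = z + λy`. -/

/-- **Pointwise form of the similarity variables** (Chae 2007, (3.13)): for `t < T`, `s < 0`,
`λ = √(T−t)` and `τ = T + λ²s`,
`λ · (v(τ, z + λy) − (T−τ)^{-1/2} V((z + λy − z)/√(T−τ))) = v_λ(s, y) − u_V(s, y)` with
`v_λ = nsRescale λ (v(T + ·, z + ·))` and `u_V = lerayBackward ½ 0 V` (since `T − τ = λ²(−s)` and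
`√(λ²(−s)) = λ√(−s)`). [cite: Chae2007, proof of Thm 1.5, (3.13) (arXiv p. 8)] -/
theorem smul_deviation_eq_nsRescale_sub_lerayBackward {t : ℝ} (ht : t < T) {s : ℝ} (hs : s < 0)
    (y : EuclideanSpace ℝ (Fin 3)) :
    Real.sqrt (T - t) •
        (v (T + Real.sqrt (T - t) ^ 2 * s) (z + Real.sqrt (T - t) • y) -
          (Real.sqrt (T - (T + Real.sqrt (T - t) ^ 2 * s)))⁻¹ •
            V ((Real.sqrt (T - (T + Real.sqrt (T - t) ^ 2 * s)))⁻¹ •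
              (z + Real.sqrt (T - t) • y - z))) =
      nsRescale (Real.sqrt (T - t)) (fun τ x => v (T + τ) (z + x)) s y -
        lerayBackward (1 / 2) 0 V s y := by
  set l : ℝ := Real.sqrt (T - t) with hl
  have hl0 : 0 < l := Real.sqrt_pos.2 (sub_pos.2 ht)
  have ha : 0 < Real.sqrt (-s) := Real.sqrt_pos.2 (neg_pos.2 hs)
  have h1 : T - (T + l ^ 2 * s) = l ^ 2 * (-s) := by ring
  have h2 : Real.sqrt (l ^ 2 * (-s)) = l * Real.sqrt (-s) := by
    rw [Real.sqrt_mul (sq_nonneg _), Real.sqrt_sq hl0.le]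
  have h3 : (2 * (1 / 2) * (0 - s) : ℝ) = -s := by ring
  have e1 : l * (l * Real.sqrt (-s))⁻¹ = (Real.sqrt (-s))⁻¹ := by
    field_simp
  have e2 : (l * Real.sqrt (-s))⁻¹ * l = (Real.sqrt (-s))⁻¹ := by
    field_simp
  rw [nsRescale_apply, lerayBackward_apply, h3, add_sub_cancel_left, h1, h2, smul_sub, smul_smul,
    smul_smul, e1, e2]

/-- **Change of variables `x = z + λy` in `L^p` over balls of `ℝ³`**: for `λ > 0`, `p < ∞`,
`‖F(z + λ·)‖_{L^p(B(0,R))} = (λ^{-3})^{1/p} ‖F‖_{L^p(B(z, λR))}` (Lebesgue measure scales by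
`λ³` under `y ↦ z + λy`, which maps `B(0, R)` onto `B(z, λR)`; Mathlib
`Measure.map_addHaar_smul`, `map_add_left_eq_self`, `MeasurableEmbedding.eLpNorm_map_measure`,
`eLpNorm_smul_measure_of_ne_top`). No measurability of `F` is needed. [folklore] -/
theorem eLpNorm_comp_add_smul_restrict_ball
    (F : EuclideanSpace ℝ (Fin 3) → EuclideanSpace ℝ (Fin 3)) (z : EuclideanSpace ℝ (Fin 3))
    {l : ℝ} (hl : 0 < l) (R : ℝ) {p : ℝ≥0∞} (hp : p ≠ ∞) :
    eLpNorm (fun y => F (z + l • y)) p (volume.restrict (ball 0 R)) =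
      ENNReal.ofReal ((l ^ 3)⁻¹) ^ (1 / p).toReal *
        eLpNorm F p (volume.restrict (ball z (l * R))) := by
  set A : EuclideanSpace ℝ (Fin 3) → EuclideanSpace ℝ (Fin 3) := fun y => z + l • y with hA
  have hAe : MeasurableEmbedding A :=
    ((Homeomorph.smulOfNeZero l hl.ne').trans (Homeomorph.addLeft z)).measurableEmbedding
  have hpre : A ⁻¹' ball z (l * R) = ball 0 R := by
    ext y
    simp only [hA, mem_preimage, mem_ball, dist_eq_norm, add_sub_cancel_left, sub_zero, norm_smul,
      Real.norm_eq_abs, abs_of_pos hl]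
    exact ⟨fun h => lt_of_mul_lt_mul_left h hl.le, fun h => mul_lt_mul_of_pos_left h hl⟩
  have hind : (ball (0 : EuclideanSpace ℝ (Fin 3)) R).indicator (fun y => F (z + l • y)) =
      (ball z (l * R)).indicator F ∘ A := by
    funext y
    rw [← hpre]
    exact (indicator_comp_right A).trans rfl
  have hmap : Measure.map A volume =
      ENNReal.ofReal ((l ^ 3)⁻¹) • (volume : Measure (EuclideanSpace ℝ (Fin 3))) := by
    have hcomp : A = (fun x => z + x) ∘ fun y => l • y := rfl
    rw [hcomp, ← Measure.map_map (measurable_const_add z) (measurable_const_smul l),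
      Measure.map_addHaar_smul volume hl.ne', Measure.map_smul, map_add_left_eq_self,
      finrank_euclideanSpace_fin, abs_of_pos (inv_pos.2 (pow_pos hl 3))]
  rw [← eLpNorm_indicator_eq_eLpNorm_restrict measurableSet_ball,
    ← eLpNorm_indicator_eq_eLpNorm_restrict measurableSet_ball, hind, ← hAe.eLpNorm_map_measure,
    hmap, eLpNorm_smul_measure_of_ne_top hp, smul_eq_mul]

/-- **The Jacobian bookkeeping** of the similarity variables: for `t < T`, `q ≠ 0` and
`λ = √(T−t)`, `‖λ‖ₑ · ((λ³)⁻¹)^{1/q} = (T−t)^{(q−3)/(2q)}` in `ℝ≥0∞`, i.e.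
`λ^{1−3/q} = (T−t)^{(q−3)/(2q)}` — the origin of Chae's power of `T − t` in (1.15). [folklore] -/
theorem enorm_sqrt_mul_rpow_eq {t : ℝ} (ht : t < T) (hq : q ≠ 0) :
    ‖Real.sqrt (T - t)‖ₑ *
        ENNReal.ofReal (((Real.sqrt (T - t)) ^ 3)⁻¹) ^ (1 / (q : ℝ≥0∞)).toReal =
      ENNReal.ofReal ((T - t) ^ (((q : ℝ) - 3) / (2 * (q : ℝ)))) := by
  set l : ℝ := Real.sqrt (T - t) with hl
  have hTt : 0 < T - t := sub_pos.2 ht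
  have hl0 : 0 < l := Real.sqrt_pos.2 hTt
  have hq0 : (0 : ℝ) < q := by exact_mod_cast pos_iff_ne_zero.2 hq
  have htoReal : (1 / (q : ℝ≥0∞)).toReal = (q : ℝ)⁻¹ := by
    rw [one_div, ENNReal.toReal_inv, ENNReal.coe_toReal]
  rw [htoReal, Real.enorm_eq_ofReal hl0.le,
    ENNReal.ofReal_rpow_of_nonneg (inv_nonneg.2 (pow_nonneg hl0.le 3)) (inv_nonneg.2 hq0.le),
    ← ENNReal.ofReal_mul hl0.le]
  congr 1
  have e1 : (l ^ 3)⁻¹ = l ^ (-3 : ℝ) := by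
    rw [Real.rpow_neg hl0.le]
    norm_cast
  calc l * ((l ^ 3)⁻¹) ^ (q : ℝ)⁻¹ = l ^ (1 : ℝ) * l ^ ((-3 : ℝ) * (q : ℝ)⁻¹) := by
          rw [e1, ← Real.rpow_mul hl0.le, Real.rpow_one]
    _ = l ^ ((1 : ℝ) + (-3) * (q : ℝ)⁻¹) := (Real.rpow_add hl0 _ _).symm
    _ = (T - t) ^ ((1 / 2 : ℝ) * ((1 : ℝ) + (-3) * (q : ℝ)⁻¹)) := by
          rw [hl, Real.sqrt_eq_rpow, ← Real.rpow_mul hTt.le]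
    _ = (T - t) ^ (((q : ℝ) - 3) / (2 * (q : ℝ))) := by
          congr 1
          field_simp
          ring

/-- **Reparametrising the time supremum**: for `t < T`, `s ↦ τ = T + (T−t)s` is a bijection of
`(−1, 0)` onto `(t, T)`, so `sup_{−1<s<0} G(T + (T−t)s) = sup_{t<τ<T} G(τ)`. [folklore] -/
theorem biSup_Ioo_reparam (G : ℝ → ℝ≥0∞) {t T : ℝ} (ht : t < T) :
    (⨆ s ∈ Ioo (-1 : ℝ) 0, G (T + (T - t) * s)) = ⨆ τ ∈ Ioo t T, G τ := by
  have hTt : 0 < T - t := sub_pos.2 ht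
  apply le_antisymm
  · refine iSup₂_le fun s hs => ?_
    have hτ : T + (T - t) * s ∈ Ioo t T := ⟨by nlinarith [hs.1], by nlinarith [hs.2]⟩
    exact le_iSup₂_of_le (f := fun τ (_ : τ ∈ Ioo t T) => G τ) (T + (T - t) * s) hτ le_rfl
  · refine iSup₂_le fun τ hτ => ?_
    have hs : (τ - T) / (T - t) ∈ Ioo (-1 : ℝ) 0 := by
      constructor
      · rw [lt_div_iff₀ hTt]; linarith [hτ.1]
      · exact div_neg_of_neg_of_pos (by linarith [hτ.2]) hTt
    have he : T + (T - t) * ((τ - T) / (T - t)) = τ := by field_simp; ring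
    exact le_iSup₂_of_le (f := fun s (_ : s ∈ Ioo (-1 : ℝ) 0) => G (T + (T - t) * s))
      ((τ - T) / (T - t)) hs (le_of_eq (by rw [he]))

/-- **Chae's deviation in similarity variables** (Chae 2007, proof of Thm 1.5, (3.13)–(3.14):
"Then, (1.15) is written as `lim_{s→∞} ‖V(·, s) − V̄‖_{L^q(B(0, R))} = 0`"), in the tree's
rescaling vocabulary: for `t < T` and `λ = √(T−t)`,
`chaeLocalDeviation T z q R v V t = sup_{−1<s<0} ‖v_λ(s) − u_V(s)‖_{L^q(B(0,R))}`, where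
`v_λ = nsRescale λ (v(T + ·, z + ·))` is the Navier–Stokes blow-up rescaling of `v` about
`(T, z)` (`v_λ(s,y) = λ v(T + λ²s, z + λy)`) and `u_V = lerayBackward ½ 0 V` the backward
self-similar field with profile `V` (`u_V(s,y) = (−s)^{-1/2} V(y/√(−s))`, `lerayBackward_half_apply`).
Proof: pointwise `smul_deviation_eq_nsRescale_sub_lerayBackward`, the change of variables
`eLpNorm_comp_add_smul_restrict_ball`, the bookkeeping `enorm_sqrt_mul_rpow_eq`
(`λ · λ^{-3/q} = (T−t)^{(q−3)/(2q)}`) and the reparametrisation `τ = T + λ²s` of `(t, T)` by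
`(−1, 0)` (`biSup_Ioo_reparam`); for `q = 0` both sides vanish. [cite: Chae2007, proof of Thm 1.5, (3.13)–(3.14) (arXiv p. 8)] -/
theorem chaeLocalDeviation_eq_iSup_similarity {t : ℝ} (ht : t < T) (R : ℝ) :
    chaeLocalDeviation T z q R v V t =
      ⨆ s ∈ Ioo (-1 : ℝ) 0, eLpNorm
        (fun y => nsRescale (Real.sqrt (T - t)) (fun τ x => v (T + τ) (z + x)) s y -
          lerayBackward (1 / 2) 0 V s y)
        (q : ℝ≥0∞) (volume.restrict (ball 0 R)) := by
  rcases eq_or_ne q 0 with hq | hq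
  · subst hq
    simp [chaeLocalDeviation_def]
  have hTt : 0 < T - t := sub_pos.2 ht
  have hl0 : 0 < Real.sqrt (T - t) := Real.sqrt_pos.2 hTt
  have hl2 : Real.sqrt (T - t) ^ 2 = T - t := Real.sq_sqrt hTt.le
  -- each term of the right-hand side, in the original variables
  have hterm : ∀ s ∈ Ioo (-1 : ℝ) 0,
      eLpNorm (fun y => nsRescale (Real.sqrt (T - t)) (fun τ x => v (T + τ) (z + x)) s y -
          lerayBackward (1 / 2) 0 V s y) (q : ℝ≥0∞) (volume.restrict (ball 0 R)) =
        ENNReal.ofReal ((T - t) ^ (((q : ℝ) - 3) / (2 * (q : ℝ)))) *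
          eLpNorm (fun x => v (T + (T - t) * s) x -
              (Real.sqrt (T - (T + (T - t) * s)))⁻¹ •
                V ((Real.sqrt (T - (T + (T - t) * s)))⁻¹ • (x - z)))
            (q : ℝ≥0∞) (volume.restrict (ball z (R * Real.sqrt (T - t)))) := by
    intro s hs
    have hfun : (fun y => nsRescale (Real.sqrt (T - t)) (fun τ x => v (T + τ) (z + x)) s y -
          lerayBackward (1 / 2) 0 V s y) =
        Real.sqrt (T - t) • fun y => (v (T + (T - t) * s) (z + Real.sqrt (T - t) • y) -
          (Real.sqrt (T - (T + (T - t) * s)))⁻¹ •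
            V ((Real.sqrt (T - (T + (T - t) * s)))⁻¹ • (z + Real.sqrt (T - t) • y - z))) := by
      funext y
      have h := smul_deviation_eq_nsRescale_sub_lerayBackward (z := z) (v := v) (V := V) ht hs.2 y
      rw [hl2] at h
      rw [Pi.smul_apply]
      exact h.symm
    rw [hfun, eLpNorm_const_smul,
      eLpNorm_comp_add_smul_restrict_ball (fun x => v (T + (T - t) * s) x -
          (Real.sqrt (T - (T + (T - t) * s)))⁻¹ •
            V ((Real.sqrt (T - (T + (T - t) * s)))⁻¹ • (x - z))) z hl0 R ENNReal.coe_ne_top,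
      ← mul_assoc, enorm_sqrt_mul_rpow_eq ht hq, mul_comm (Real.sqrt (T - t)) R]
  rw [chaeLocalDeviation_def]
  symm
  calc (⨆ s ∈ Ioo (-1 : ℝ) 0, eLpNorm
          (fun y => nsRescale (Real.sqrt (T - t)) (fun τ x => v (T + τ) (z + x)) s y -
            lerayBackward (1 / 2) 0 V s y) (q : ℝ≥0∞) (volume.restrict (ball 0 R)))
      = ⨆ s ∈ Ioo (-1 : ℝ) 0, ENNReal.ofReal ((T - t) ^ (((q : ℝ) - 3) / (2 * (q : ℝ)))) *
          eLpNorm (fun x => v (T + (T - t) * s) x -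
              (Real.sqrt (T - (T + (T - t) * s)))⁻¹ •
                V ((Real.sqrt (T - (T + (T - t) * s)))⁻¹ • (x - z)))
            (q : ℝ≥0∞) (volume.restrict (ball z (R * Real.sqrt (T - t)))) :=
        iSup_congr fun s => iSup_congr fun hs => hterm s hs
    _ = ENNReal.ofReal ((T - t) ^ (((q : ℝ) - 3) / (2 * (q : ℝ)))) *
          ⨆ s ∈ Ioo (-1 : ℝ) 0, eLpNorm (fun x => v (T + (T - t) * s) x -
              (Real.sqrt (T - (T + (T - t) * s)))⁻¹ •
                V ((Real.sqrt (T - (T + (T - t) * s)))⁻¹ • (x - z)))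
            (q : ℝ≥0∞) (volume.restrict (ball z (R * Real.sqrt (T - t)))) := by
        simp only [ENNReal.mul_iSup]
    _ = _ := by
        rw [biSup_Ioo_reparam (fun τ => eLpNorm (fun x => v τ x -
              (Real.sqrt (T - τ))⁻¹ • V ((Real.sqrt (T - τ))⁻¹ • (x - z)))
            (q : ℝ≥0∞) (volume.restrict (ball z (R * Real.sqrt (T - t))))) ht]

/-- **Chae's hypothesis as convergence of the blow-up rescalings** (Chae 2007, (3.14)): if
`dev(R, t) → 0` as `t ↑ T`, then
`sup_{−1<s<0} ‖v_λ(s) − u_V(s)‖_{L^q(B(0,R))} → 0` as `λ ↓ 0`, where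
`v_λ = nsRescale λ (v(T + ·, z + ·))` and `u_V = lerayBackward ½ 0 V`: along `t = T − λ²`
(which tends to `T` from below as `λ ↓ 0`) the two quantities agree by
`chaeLocalDeviation_eq_iSup_similarity` (`√(λ²) = λ`). This is the form in which a limit
`λ → 0` of the rescaled Navier–Stokes solutions `v_λ` is taken in the printed proof.
[cite: Chae2007, proof of Thm 1.5, (3.14) (arXiv p. 8)] -/
theorem tendsto_iSup_nsRescale_sub_lerayBackward {R : ℝ}
    (h : Tendsto (chaeLocalDeviation T z q R v V) (𝓝[<] T) (𝓝 0)) :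
    Tendsto (fun l : ℝ => ⨆ s ∈ Ioo (-1 : ℝ) 0, eLpNorm
        (fun y => nsRescale l (fun τ x => v (T + τ) (z + x)) s y - lerayBackward (1 / 2) 0 V s y)
        (q : ℝ≥0∞) (volume.restrict (ball 0 R))) (𝓝[>] 0) (𝓝 0) := by
  -- `λ ↦ T - λ²` tends to `T` from below as `λ ↓ 0`
  have hφc : Continuous fun l : ℝ => T - l ^ 2 := by fun_prop
  have hmaps : MapsTo (fun l : ℝ => T - l ^ 2) (Ioi 0) (Iio T) := by
    intro l hl
    simp only [mem_Ioi, mem_Iio] at hl ⊢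
    nlinarith
  have hφ : Tendsto (fun l : ℝ => T - l ^ 2) (𝓝[>] 0) (𝓝[<] T) := by
    have h1 := hφc.continuousWithinAt.tendsto_nhdsWithin hmaps (x := 0) (s := Ioi 0)
    simpa using h1
  refine (h.comp hφ).congr' ?_
  filter_upwards [self_mem_nhdsWithin] with l hl
  have hl' : (0 : ℝ) < l := hl
  have ht : T - l ^ 2 < T := by nlinarith
  rw [Function.comp_apply, chaeLocalDeviation_eq_iSup_similarity ht R,
    show T - (T - l ^ 2) = l ^ 2 by ring, Real.sqrt_sq hl'.le]

end Literature.Analysis.FluidPDE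

end
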